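import Mathlib
import HarnessLib
import Summits.ValiantsHypothesis.ValiantsHypothesis.Theses.MonotoneRestoration
import Summits.ValiantsHypothesis.ValiantsHypothesis.Theorems.MonotoneRestorationOrbitRestorationQPNarrowExpressions
import Summits.ValiantsHypothesis.ValiantsHypothesis.Theorems.MonotoneRestorationOrbitRestorationQPHomPolyClose

/-!
# Route MonotoneRestoration — crux `OrbitRestorationLinearVolumeQP` (stmt-ValiantsHypothesis-18294):
# the linear-volume crux rests on its narrow-span stub alone

The registered skeleton of the linear-volume re-target R1 = `OrbitRestorationLinearVolumeQP`
(skeleton `0500973389fe`, line `birth`) composes three stubs,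
`stub_lvNarrowSpan → stub_homPoly_close → stub_close_orbit → OrbitRestorationLinearVolumeQP`.
The last two are the folklore bridges K2 (treewidth `≤ w` patterns are closed labelled pattern
expressions with `w + 1` labels a side, `OrbitRestorationQPHomPolyClose.stub_homPoly_close`) and K3 (the
length-free orbit bound `(n+1)^(k+l+2)` for closed expressions, `Theorems.stub_close_orbit`), both
THEOREMS of the tree (landed for the parent crux `OrbitRestorationQP`, stmt-ValiantsHypothesis-18293).
This file records the consequence for R1 in the Theorems tree, with K2 and K3 discharged:

* `orbitRestorationLinearVolumeQP_of_lvNarrowSpan` — R1 follows from the LINEAR-VOLUME NARROW-SPAN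
  statement alone: every `VP` family that is, level by level, a polynomial-dimension combination of
  homomorphism polynomials of linear-volume bipartite patterns lies, for one constant `c` and every `n`,
  in the `ℂ`-span of the homomorphism polynomials of patterns of treewidth `≤ (log₂ n + c)^c`
  (the R1-class restriction of the parent's K1 `NarrowExpansionVP`; conjecture-grade — it is
  Dwivedi–Pago–Seppelt's Outlook question at quasi-polynomial scale, arXiv:2601.09343 p. 12);
* `orbitRestorationLinearVolumeQP_of_lvNarrowExpressions` — the same from the (formally weaker)
  EXPRESSION form: `f n` is, for `n ≥ 1`, the closed polynomial of some labelled pattern expression with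
  `(log₂ n + c)^c` labels a side, of any length.

Nothing here is deep: span certificate → one closed expression (K2 + linearity of `close`,
`narrowExpression_of_mem_narrowSpan`) → length-free symmetric circuit (K3, `qpOrbit_of_close_eq`);
`n = 0` is a constant.  VP ≠ VNP is not moved; R1 itself stays open (and is VH-strength modulo the
linear-volume hom-CFI separation in print, see the skeleton's `valiantsHypothesis_of_linearVolume`).

References: Dwivedi–Pago–Seppelt 2026 (arXiv:2601.09343) eq. (1), Outlook Q3; Dawar–Pago–Seppelt 2025
(arXiv:2502.06740) §5.
-/

noncomputable section

-- `Summit.ValiantsHypothesis.ValiantsHypothesis.…` is the tree's single-conjunct layout (Sub = Summit).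
set_option linter.dupNamespace false

namespace Summit.ValiantsHypothesis.ValiantsHypothesis.Theorems.OrbitRestorationLinearVolumeQPNarrow

open Literature.Computability.AlgebraicComplexity
open Summit.ValiantsHypothesis.ValiantsHypothesis.Theorems.OrbitRestorationQPHomPolyClose

/-- **R1 from narrow expressions.** If every `VP` family of the linear-volume class (level by level a
combination of `≤ (n+2)^c` homomorphism polynomials of bipartite patterns with `≤ c (n+1)` vertices) is,
for one constant `c'` and every `n ≥ 1`, the closed polynomial of SOME labelled pattern expression over
`ℂ` with `(log₂ n + c')^c'` row and column labels, then `OrbitRestorationLinearVolumeQP` holds (constant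
`c' + 3`; K3 `stub_close_orbit` supplies the circuit, `n = 0` is a constant gate). [folklore] -/
theorem orbitRestorationLinearVolumeQP_of_lvNarrowExpressions
    (h : ∀ f : (n : ℕ) → MvPolynomial (Fin n × Fin n) ℂ, IsVPFamily f →
      (∃ (c : ℕ) (m : ℕ → ℕ) (a b : (n : ℕ) → Fin (m n) → ℕ)
          (E : (n : ℕ) → (i : Fin (m n)) → Multiset (Fin (a n i) × Fin (b n i)))
          (α : (n : ℕ) → Fin (m n) → ℂ),
        (∀ n, m n ≤ (n + 2) ^ c) ∧ (∀ n i, a n i + b n i ≤ c * (n + 1)) ∧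
          ∀ n, f n = ∑ i : Fin (m n), MvPolynomial.C (α n i) * homPoly (E n i) n ℂ) →
      ∃ c : ℕ, ∀ n : ℕ, 1 ≤ n →
        ∃ e : PatternExpr ℂ ((Nat.log 2 n + c) ^ c) ((Nat.log 2 n + c) ^ c), e.close n = f n) :
    Summit.ValiantsHypothesis.ValiantsHypothesis.Theses.MonotoneRestoration.OrbitRestorationLinearVolumeQP := by
  intro f hVP hLV
  obtain ⟨c, hc⟩ := h f hVP hLV
  refine ⟨c + 3, fun n => ?_⟩
  rcases Nat.eq_zero_or_pos n with rfl | hn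
  · -- `n = 0`: no variables, `f 0` is the constant `coeff 0 (f 0)` (a constant gate, orbit `1`)
    obtain ⟨G, inst, C, hC, hev, horb⟩ :=
      stub_close_orbit 0 0 0 (PatternExpr.const (MvPolynomial.coeff 0 (f 0)))
    refine ⟨G, inst, C, hC, ?_, horb.trans (le_trans (by norm_num) Nat.one_le_two_pow)⟩
    rw [hev, narrowExpansion_close_const]
    exact (MvPolynomial.eq_C_of_isEmpty (f 0)).symm
  · obtain ⟨e, he⟩ := hc n hn
    exact qpOrbit_of_close_eq n c (f n) e he

/-- **R1 rests on the linear-volume narrow-span statement alone** (the R1-class restriction of the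
parent crux's K1 `NarrowExpansionVP`; K2 `stub_homPoly_close` and K3 `stub_close_orbit` are theorems of
the tree): if every `VP` family of the linear-volume class lies, for one constant `c'` and every `n`, in
the `ℂ`-span of the homomorphism polynomials of bipartite patterns of treewidth `≤ (log₂ n + c')^c'`,
then `OrbitRestorationLinearVolumeQP` holds (constant `c' + 5`). [folklore] -/
theorem orbitRestorationLinearVolumeQP_of_lvNarrowSpan
    (h : ∀ f : (n : ℕ) → MvPolynomial (Fin n × Fin n) ℂ, IsVPFamily f →
      (∃ (c : ℕ) (m : ℕ → ℕ) (a b : (n : ℕ) → Fin (m n) → ℕ)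
          (E : (n : ℕ) → (i : Fin (m n)) → Multiset (Fin (a n i) × Fin (b n i)))
          (α : (n : ℕ) → Fin (m n) → ℂ),
        (∀ n, m n ≤ (n + 2) ^ c) ∧ (∀ n i, a n i + b n i ≤ c * (n + 1)) ∧
          ∀ n, f n = ∑ i : Fin (m n), MvPolynomial.C (α n i) * homPoly (E n i) n ℂ) →
      ∃ c : ℕ, ∀ n : ℕ, f n ∈ Submodule.span ℂ
        {p : MvPolynomial (Fin n × Fin n) ℂ | ∃ (a b : ℕ) (E : Multiset (Fin a × Fin b)),
          Literature.Combinatorics.SimpleGraph.treewidth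
              (SimpleGraph.fromRel fun u v : Fin a ⊕ Fin b =>
                ∃ e ∈ E, u = Sum.inl e.1 ∧ v = Sum.inr e.2) ≤ (Nat.log 2 n + c) ^ c ∧
            p = homPoly E n ℂ}) :
    Summit.ValiantsHypothesis.ValiantsHypothesis.Theses.MonotoneRestoration.OrbitRestorationLinearVolumeQP := by
  refine orbitRestorationLinearVolumeQP_of_lvNarrowExpressions fun f hVP hLV => ?_
  obtain ⟨c, hc⟩ := h f hVP hLV
  exact ⟨c + 2, fun n hn =>
    narrowExpression_of_mem_narrowSpan stub_homPoly_close n c hn (f n) (hc n)⟩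

end Summit.ValiantsHypothesis.ValiantsHypothesis.Theorems.OrbitRestorationLinearVolumeQPNarrow

end
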